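import Mathlib.GroupTheory.FiniteAbelian.Duality
import Mathlib.RingTheory.RootsOfUnity.AlgebraicallyClosed
import Mathlib.RingTheory.Trace.Basic
import Mathlib.RingTheory.IntegralClosure.IntegrallyClosed
import Mathlib.NumberTheory.NumberField.InfinitePlace.Embeddings
import Literature.NumberTheory.EllipticCurves.KatoTwistedFinitenessProofs
import Literature.NumberTheory.EllipticCurves.MordellWeilTheoremProofs
import HarnessLib

/-!
# Kato's `χ`-parts: the remark on `χ`-quotients (Astérisque 295, p. 236) and the isotypic
# decomposition of a `ℤ[G]`-module by its `χ`-parts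

Topic `Literature/NumberTheory/EllipticCurves`; theorems only (no definition, no named fact).

K. Kato, *`p`-adic Hodge theory and values of zeta functions of modular forms*, Astérisque 295
(2004), defines (p. 235, after Thm. 14.2), for a finite abelian group `G = Gal(K/ℚ)`, a character
`χ : G → ℂˣ` and a `G`-module `M`, the `χ`-part `M^(χ) = {x ∈ M ; I_χ · x = 0}`,
`I_χ = ker(ℤ[G] → ℂ)` — the tree's `Literature.NumberTheory.EllipticCurves.chiPart` — proves
(Thm. 14.2 (2), Cor. 14.3 (2)) that `L(E, χ, 1) ≠ 0` forces `E(K)^(χ)` to be finite (vendored as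
the named fact `kato_finite_chiPart_of_twistedLValue_ne_zero`, `K = ℚ(ζ_m)`, `m ≢ 2 (mod 4)`; all
moduli `m` by the theorem `kato_finite_chiPart_cyclotomic_of_twistedLValue_ne_zero_of` of
`KatoTwistedFinitenessProofs`), and remarks (p. 236):

> "We can replace the "`χ`-parts" `Sel(K, T)^(χ)`, `Sel(K, A ⊗_ℚ K)^(χ)` and `A(K)^(χ)` in 14.2
> and 14.3 by the "`χ`-quotients" `Sel(K, T)_(χ)`, `Sel(K, A ⊗_ℚ K)_(χ)` and `A(K)_(χ)`,
> respectively, where `M_(χ) = M / I_χ M` for a `G`-module `M`. This is because the kernel and the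
> cokernel of the canonical map `M^(χ) → M_(χ)` are killed by some non-zero integer, and because
> for `M = Sel(K, T)`, `Sel(K, A ⊗_ℚ K)` or `A(K)`, the kernel and the cokernel of `n : M → M` are
> finite for any non-zero integer `n`."

This file proves the algebra behind that remark for an arbitrary additive group `M` with a
`G`-action `ρ` (`G` finite abelian), by the classical device of the **integral orbit projector**
`t_χ = ∑_{g ∈ G} Tr_{K/ℚ}(χ(g)⁻¹) · g ∈ ℤ[G]` (`K` a number field containing the values of `χ`;
the trace of a root of unity is a rational integer), and draws the consequences used by the
consumers of Kato's Cor. 14.3 (2) in the tree (route `PlecticLegs` of the BSD summit, item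
`KatoDescent`; crux `KatoRankZeroSeven` of the Langlands summit, stub `isotypicDescent`):

* `sum_trace_smul_mem_chiPart` — `t_χ · x ∈ M^(χ)` for every `x ∈ M` (`I_χ t_χ` acts as `0`:
  the coefficient of `k` in `a · t_χ` is `Tr(χ(k)⁻¹ χ(a)) = 0` for `a ∈ I_χ`);
* `sum_trace_mul_eq_card_mul_card` — `χ(t_χ) = |G| · #{σ ∈ Gal(K/ℚ) ; σ ∘ χ = χ} =: N_χ > 0`
  (`K/ℚ` Galois; `Tr = ∑_σ σ` and orthogonality of characters), so `N_χ − t_χ ∈ I_χ`;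
* **Kato's remark** `smul_eq_zero_of_mem_chiPart_of_mem_closure`,
  `exists_mem_chiPart_sub_mem_closure` (and `exists_pos_chiPart_chiQuotient_complex` for
  `ℂ`-valued characters): `N_χ` kills `M^(χ) ∩ I_χ M` (the kernel of `M^(χ) → M_(χ)`) and
  `N_χ · M ⊂ M^(χ) + I_χ M` (the cokernel);
* **isotypic decomposition** `card_mul_finrank_smul_mem_iSup_chiPart`,
  `exponent_mul_smul_mem_iSup_chiPart_of_forall_apply_eq`,
  `exists_pos_smul_mem_iSup_chiPart_complex`:
  `∑_χ t_χ = |G| [K:ℚ] · 1` (dual orthogonality `∑_χ χ(g) = |G| δ_{g,1}`), hence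
  `(|G| [K:ℚ]) · x ∈ ∑_χ M^(χ)` for every `x`; and if `x` is fixed by a subset `H ⊂ G`, the
  characters non-trivial on `H` only contribute `exp(G)`-torsion (for `h ∈ H` with `χ(h) ≠ 1` of
  order `d`, `∑_{j<d} h^j ∈ I_χ` acts on `h`-fixed elements as `d`), so a non-zero multiple of `x`
  lies in `∑_{χ|_H = 1} M^(χ)`;
* `chiPart_comp_of_injective` — `M^(ι ∘ χ) = M^(χ)` for an injective ring map `ι` (Kato's `χ`-part
  only depends on the `Aut(ℂ)`-orbit of `χ`), and `exists_monoidHom_map_eq` — `ℂ`-valued characters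
  of `G` come from `ℚ(ζ_e)`, `e = exp(G)`; this transfers everything to `ℂ`-valued characters;
* **torsion of fixed points** `isOfFinAddOrder_of_forall_finite_chiPart`: if `M^(χ)` is finite for
  every `χ : G → ℂˣ` trivial on `H`, every `H`-fixed element of `M` has finite order; for
  `M = E(ℚ(ζ_m))`, `G = Gal(ℚ(ζ_m)/ℚ)` and Dirichlet characters
  (`isOfFinAddOrder_point_of_forall_finite_chiPart`, `exists_cyclotomicCharacterOf_eq`);
* **consumer form of Cor. 14.3 (2)** `isOfFinAddOrder_point_of_kato_of_twistedLValue_ne_zero`,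
  `finite_point_cyclotomic_of_kato_of_forall_twistedLValue_ne_zero`: under the vendored fact
  `kato_finite_chiPart_of_twistedLValue_ne_zero` (through its all-moduli form
  `kato_finite_chiPart_cyclotomic_of_twistedLValue_ne_zero_of`), if `L(E, χ, 1) ≠ 0` for every
  Dirichlet character `χ` mod `m` trivial on `H ⊂ Gal(ℚ(ζ_m)/ℚ)` then every `H`-fixed point of
  `E(ℚ(ζ_m))` — in particular every point of `E` over the fixed field of `H` — is torsion, and for
  `H = ∅` the Mordell–Weil group `E(ℚ(ζ_m))` is finite (Mordell–Weil, `addGroup_fg_point_holds`).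
  (Compare Kato's Thm. 14.4, p. 236, the `ℚ(ζ_{p^∞})` version via Rohrlich's non-vanishing.)

Nothing here proves Kato's theorem itself (an Euler-system argument); the named facts stay cited.

## References

* K. Kato, *`p`-adic Hodge theory and values of zeta functions of modular forms*, Astérisque 295
  (2004), 117–290: Thm. 14.2, Cor. 14.3 (p. 235: definition of `M^(χ)`), the remark on
  `χ`-quotients and Thm. 14.4 (p. 236). [Kato2004Asterisque]
* J.-P. Serre, *Linear Representations of Finite Groups*, GTM 42 (1977), §2.6 Thm. 8 and §12.1
  (isotypic projectors `(n_χ/|G|) ∑ χ(g)⁻¹ g`; rational characters and Galois orbits). [folklore]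
-/

noncomputable section

open scoped BigOperators

namespace Literature.NumberTheory.EllipticCurves

section General

variable {G M R S : Type*} [AddCommGroup M] [CommRing R] [CommRing S]

/-- **Kato's `χ`-part only depends on the orbit of `χ` under injective ring maps**: for
`ι : R → S` injective, `I_{ι ∘ χ} = I_χ` (`∑ n_g ι(χ(g)) = ι(∑ n_g χ(g))`), hence
`M^(ι ∘ χ) = M^(χ)`. In particular `M^(σ ∘ χ) = M^(χ)` for `σ ∈ Aut(ℂ)` (Galois-conjugate
characters have the same `χ`-part) and `χ`-parts of `ℂ`-valued characters may be computed in
any subfield containing the values (Kato, Astérisque 295, p. 235, definition of `M^(χ)`).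
[cite: Kato2004Asterisque, §14 Thm. 14.2 (p. 235)] -/
theorem chiPart_comp_of_injective (ρ : G → M →+ M) (χ : G → R) (ι : R →+* S)
    (hι : Function.Injective ι) :
    chiPart ρ (fun g => ι (χ g)) = chiPart ρ χ := by
  ext x
  simp only [mem_chiPart_iff]
  refine forall_congr' fun a => ?_
  have h : (a.sum fun g n => (n : S) * ι (χ g)) = ι (a.sum fun g n => (n : R) * χ g) := by
    rw [map_finsuppSum]
    simp
  rw [h, map_eq_zero_iff ι hι]

/-- Membership in `M^(χ)` for a finite group `G`, with elements of `ℤ[G]` written as functions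
`c : G → ℤ`: `x ∈ M^(χ)` iff every `c` with `∑_g c(g) χ(g) = 0` satisfies `∑_g c(g) ρ(g) x = 0`.
[cite: Kato2004Asterisque, §14 Thm. 14.2 (p. 235)] -/
theorem mem_chiPart_iff_fintype [Fintype G] (ρ : G → M →+ M) (χ : G → R) (x : M) :
    x ∈ chiPart ρ χ ↔
      ∀ c : G → ℤ, (∑ g, (c g : R) * χ g) = 0 → (∑ g, c g • ρ g x) = 0 := by
  rw [mem_chiPart_iff]
  constructor
  · intro h c hc
    have key := h (Finsupp.equivFunOnFinite.symm c)
    rw [Finsupp.sum_fintype _ _ (fun _ => by simp), Finsupp.sum_fintype _ _ (fun _ => by simp)]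
      at key
    simpa using key (by simpa using hc)
  · intro h a ha
    rw [Finsupp.sum_fintype _ _ (fun _ => by simp)]
    exact h a (by rwa [Finsupp.sum_fintype _ _ (fun _ => by simp)] at ha)

end General

section Engine

variable {G : Type*} [CommGroup G] [Fintype G]
variable {M : Type*} [AddCommGroup M]
variable (K : Type*) [Field K]

/-- **Orthogonality of characters, first form**: for a finite group `G` and a character
`φ : G → Kˣ` into a field, `∑_g φ(g) = |G|` if `φ = 1` and `0` otherwise (Mathlib
`sum_hom_units_eq_zero`). [folklore] -/
theorem sum_coe_monoidHom_eq (φ : G →* Kˣ) [Decidable (φ = 1)] :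
    (∑ g, ((φ g : Kˣ) : K)) = if φ = 1 then (Fintype.card G : K) else 0 := by
  split_ifs with h
  · simp [h]
  · have h' : (Units.coeHom K).comp φ ≠ 1 := by
      intro h1
      apply h
      ext g
      have := DFunLike.congr_fun h1 g
      simpa using this
    simpa using sum_hom_units_eq_zero ((Units.coeHom K).comp φ) h'

/-- The character group `Hom(G, Kˣ)` of a finite abelian group is finite when `K` has enough
roots of unity (it has `|G|` elements, Mathlib `CommGroup.card_monoidHom_of_hasEnoughRootsOfUnity`).
[folklore] -/
theorem finite_monoidHom_units [HasEnoughRootsOfUnity K (Monoid.exponent G)] :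
    Finite (G →* Kˣ) := by
  apply Nat.finite_of_card_ne_zero
  rw [CommGroup.card_monoidHom_of_hasEnoughRootsOfUnity G K]
  exact Nat.card_pos.ne'

/-- **Orthogonality of characters, dual form**: for a finite abelian group `G` and a field `K`
with enough `exp(G)`-th roots of unity, `∑_{φ : G → Kˣ} φ(g) = |G|` if `g = 1` and `0` otherwise
(characters separate points, Mathlib `CommGroup.exists_apply_ne_one_of_hasEnoughRootsOfUnity`, and
`Hom(G, Kˣ)` has `|G|` elements). [folklore] -/
theorem sum_monoidHom_apply_eq [HasEnoughRootsOfUnity K (Monoid.exponent G)]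
    [Fintype (G →* Kˣ)] (g : G) [Decidable (g = 1)] :
    (∑ φ : G →* Kˣ, ((φ g : Kˣ) : K)) = if g = 1 then (Fintype.card G : K) else 0 := by
  split_ifs with h
  · subst h
    simp only [map_one, Units.val_one, Finset.sum_const, Finset.card_univ, nsmul_eq_mul, mul_one]
    congr 1
    rw [← Nat.card_eq_fintype_card, CommGroup.card_monoidHom_of_hasEnoughRootsOfUnity G K,
      Nat.card_eq_fintype_card]
  · obtain ⟨ψ, hψ⟩ := CommGroup.exists_apply_ne_one_of_hasEnoughRootsOfUnity G K h
    set S := ∑ φ : G →* Kˣ, ((φ g : Kˣ) : K) with hS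
    have hre : S = ((ψ g : Kˣ) : K) * S := by
      rw [hS, Finset.mul_sum]
      refine (Fintype.sum_equiv (Equiv.mulLeft ψ) _ _ fun φ => ?_).symm
      simp
    have hψ' : ((ψ g : Kˣ) : K) - 1 ≠ 0 := by
      rw [sub_ne_zero]
      exact fun h1 => hψ (Units.ext h1)
    have : (((ψ g : Kˣ) : K) - 1) * S = 0 := by rw [sub_mul, one_mul, ← hre, sub_self]
    exact (mul_eq_zero.mp this).resolve_left hψ'


variable [CharZero K]

/-- **The coefficients of the orbit projector are integers.** For a character `χ : G → Kˣ` of a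
finite group with values in a number field `K`, `g ↦ Tr_{K/ℚ}(χ(g)⁻¹)` takes values in `ℤ`:
`χ(g)⁻¹` is a root of unity, hence integral over `ℤ`, so is its trace (Mathlib
`Algebra.isIntegral_trace`), and `ℤ` is integrally closed. [folklore] -/
theorem exists_int_cast_eq_trace [FiniteDimensional ℚ K] (χ : G →* Kˣ) :
    ∃ T : G → ℤ, ∀ g, (T g : ℚ) = Algebra.trace ℚ K (((χ g)⁻¹ : Kˣ) : K) := by
  have h : ∀ g : G, ∃ z : ℤ, (z : ℚ) = Algebra.trace ℚ K (((χ g)⁻¹ : Kˣ) : K) := fun g => by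
    have he : Monoid.exponent G ≠ 0 := Monoid.exponent_ne_zero_of_finite
    have hpow : ((((χ g)⁻¹ : Kˣ) : K)) ^ Monoid.exponent G = 1 := by
      rw [← Units.val_pow_eq_pow_val, ← map_inv, ← map_pow, Monoid.pow_exponent_eq_one, map_one,
        Units.val_one]
    have hint : IsIntegral ℤ ((((χ g)⁻¹ : Kˣ) : K)) := by
      refine IsIntegral.of_pow (Nat.pos_of_ne_zero he) ?_
      rw [hpow]
      exact isIntegral_one
    obtain ⟨z, hz⟩ := (IsIntegrallyClosed.isIntegral_iff (R := ℤ) (K := ℚ)).mp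
      (Algebra.isIntegral_trace (L := ℚ) hint)
    exact ⟨z, by simpa using hz⟩
  choose T hT using h
  exact ⟨T, hT⟩

/-- `exists_int_cast_eq_trace` for all characters at once: an integer-valued family
`T_χ(g) = Tr_{K/ℚ}(χ(g)⁻¹)`. [folklore] -/
theorem exists_int_cast_eq_trace_family [FiniteDimensional ℚ K] :
    ∃ T : (G →* Kˣ) → G → ℤ, ∀ χ g, (T χ g : ℚ) = Algebra.trace ℚ K (((χ g)⁻¹ : Kˣ) : K) := by
  choose T hT using fun χ : G →* Kˣ => exists_int_cast_eq_trace K χ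
  exact ⟨T, hT⟩

/-- For a commutative group `G` acting by `ρ` (`ρ(gh) = ρ(g)ρ(h)`), the operators
`∑_h a(h) ρ(h)` and `∑_g b(g) ρ(g)` of `ℤ[G]` commute on `M`. [folklore] -/
theorem sum_smul_apply_sum_smul_comm (ρ : G → M →+ M) (hmul : ∀ g h x, ρ (g * h) x = ρ g (ρ h x))
    (a b : G → ℤ) (x : M) :
    (∑ h, a h • ρ h (∑ g, b g • ρ g x)) = ∑ g, b g • ρ g (∑ h, a h • ρ h x) := by
  have h1 : ∀ (c d : G → ℤ), (∑ h, c h • ρ h (∑ g, d g • ρ g x)) =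
      ∑ h, ∑ g, (c h * d g) • ρ (h * g) x := fun c d => by
    refine Finset.sum_congr rfl fun h _ => ?_
    rw [map_sum, Finset.smul_sum]
    refine Finset.sum_congr rfl fun g _ => ?_
    rw [map_zsmul, smul_smul, hmul]
  rw [h1, h1, Finset.sum_comm]
  refine Finset.sum_congr rfl fun g _ => Finset.sum_congr rfl fun h _ => ?_
  rw [mul_comm (a h), mul_comm h g]

/-- **The orbit projector lands in the `χ`-part**: with `T(g) = Tr_{K/ℚ}(χ(g)⁻¹) ∈ ℤ` and
`t_χ = ∑_g T(g) g ∈ ℤ[G]`, `t_χ · x = ∑_g T(g) ρ(g) x ∈ M^(χ)` for every `x ∈ M`. Indeed for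
`c ∈ I_χ` (`∑ c(g) χ(g) = 0`), `c · (t_χ · x) = ∑_k (∑_g c(g) T(g⁻¹k)) ρ(k) x` and
`∑_g c(g) Tr(χ(k⁻¹ g)) = Tr(χ(k)⁻¹ ∑_g c(g) χ(g)) = 0` by `ℚ`-linearity of the trace. (This is
the integral form of the isotypic projector `|G|⁻¹ ∑ χ(g⁻¹) g` of Serre, *Linear Representations*,
§2.6 Thm. 8, summed over the Galois conjugates of `χ`.) [folklore] -/
theorem sum_trace_smul_mem_chiPart [FiniteDimensional ℚ K] (ρ : G → M →+ M)
    (hmul : ∀ g h x, ρ (g * h) x = ρ g (ρ h x)) (χ : G →* Kˣ) {T : G → ℤ}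
    (hT : ∀ g, (T g : ℚ) = Algebra.trace ℚ K (((χ g)⁻¹ : Kˣ) : K)) (x : M) :
    (∑ g, T g • ρ g x) ∈ chiPart ρ (fun g => ((χ g : Kˣ) : K)) := by
  rw [mem_chiPart_iff_fintype]
  intro c hc
  have h1 : ∀ g, ρ g (∑ h, T h • ρ h x) = ∑ k, T (g⁻¹ * k) • ρ k x := by
    intro g
    rw [map_sum]
    simp_rw [map_zsmul, ← hmul]
    exact Fintype.sum_equiv (Equiv.mulLeft g) _ _ (fun h => by simp)
  simp_rw [h1, Finset.smul_sum, smul_smul]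
  rw [Finset.sum_comm]
  simp_rw [← Finset.sum_smul]
  have hcoef : ∀ k, (∑ g, c g * T (g⁻¹ * k)) = 0 := by
    intro k
    have hq : ((∑ g, c g * T (g⁻¹ * k) : ℤ) : ℚ) =
        Algebra.trace ℚ K ((((χ k)⁻¹ : Kˣ) : K) * ∑ g, (c g : K) * ((χ g : Kˣ) : K)) := by
      rw [Finset.mul_sum, map_sum, Int.cast_sum]
      refine Finset.sum_congr rfl fun g _ => ?_
      have e1 : ((((χ (g⁻¹ * k))⁻¹ : Kˣ) : K)) = (((χ k)⁻¹ : Kˣ) : K) * ((χ g : Kˣ) : K) := by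
        rw [map_mul, map_inv, mul_inv_rev, inv_inv, Units.val_mul]
      have e2 : ((((χ k)⁻¹ : Kˣ) : K)) * ((c g : K) * ((χ g : Kˣ) : K)) =
          (c g : ℤ) • (((((χ k)⁻¹ : Kˣ) : K)) * ((χ g : Kˣ) : K)) := by
        rw [zsmul_eq_mul]
        ring
      rw [Int.cast_mul, hT, e1, e2, map_zsmul, zsmul_eq_mul]
    rw [hc, mul_zero, map_zero] at hq
    exact_mod_cast hq
  simp [hcoef]

/-- **The orbit projectors sum to `|G| [K:ℚ]`**: `∑_χ Tr_{K/ℚ}(χ(g)⁻¹) = Tr(∑_χ χ(g⁻¹))` is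
`|G| [K:ℚ]` for `g = 1` and `0` otherwise (dual orthogonality `sum_monoidHom_apply_eq`,
`Tr(q) = [K:ℚ] q` for `q ∈ ℚ`), i.e. `∑_χ t_χ = |G| [K:ℚ] · 1` in `ℤ[G]`. [folklore] -/
theorem sum_trace_family_eq [FiniteDimensional ℚ K] [HasEnoughRootsOfUnity K (Monoid.exponent G)]
    [Fintype (G →* Kˣ)] [DecidableEq G] {T : (G →* Kˣ) → G → ℤ}
    (hT : ∀ χ g, (T χ g : ℚ) = Algebra.trace ℚ K (((χ g)⁻¹ : Kˣ) : K)) (g : G) :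
    (∑ χ, T χ g) = if g = 1 then ((Fintype.card G * Module.finrank ℚ K : ℕ) : ℤ) else 0 := by
  have hq : ((∑ χ, T χ g : ℤ) : ℚ) =
      Algebra.trace ℚ K (∑ χ : G →* Kˣ, (((χ g)⁻¹ : Kˣ) : K)) := by
    rw [Int.cast_sum]
    simp_rw [hT]
    rw [map_sum]
  have hsum : (∑ χ : G →* Kˣ, (((χ g)⁻¹ : Kˣ) : K)) =
      if g = 1 then (Fintype.card G : K) else 0 := by
    have h := sum_monoidHom_apply_eq K g⁻¹
    simp_rw [map_inv] at h
    simpa only [inv_eq_one] using h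
  rw [hsum] at hq
  split_ifs at hq with h
  · rw [show ((Fintype.card G : K)) = algebraMap ℚ K (Fintype.card G : ℚ) by simp,
      Algebra.trace_algebraMap, nsmul_eq_mul] at hq
    rw [if_pos h]
    have hq' : ((∑ χ, T χ g : ℤ) : ℚ) = (((Fintype.card G * Module.finrank ℚ K : ℕ) : ℤ) : ℚ) := by
      rw [hq]
      push_cast
      ring
    exact_mod_cast hq'
  · rw [map_zero] at hq
    rw [if_neg h]
    exact_mod_cast hq

/-- **Isotypic decomposition by `χ`-parts (integral form).** Let `G` be a finite abelian group
acting on `M` by `ρ` (`ρ(1) = id`, `ρ(gh) = ρ(g)ρ(h)`) and `K` a number field with enough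
`exp(G)`-th roots of unity. Then `(|G| · [K:ℚ]) x ∈ ∑_{χ : G → Kˣ} M^(χ)` for every `x ∈ M`:
`|G| [K:ℚ] x = ∑_χ t_χ · x` (`sum_trace_family_eq`) with `t_χ · x ∈ M^(χ)`
(`sum_trace_smul_mem_chiPart`). Compare `M ⊗ ℚ = ⊕ M ⊗ ℚ`-isotypic components (Serre, §2.6,
§12.1); no tensoring is needed here. [folklore] -/
theorem card_mul_finrank_smul_mem_iSup_chiPart [FiniteDimensional ℚ K]
    [HasEnoughRootsOfUnity K (Monoid.exponent G)] (ρ : G → M →+ M) (hone : ∀ x, ρ 1 x = x)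
    (hmul : ∀ g h x, ρ (g * h) x = ρ g (ρ h x)) (x : M) :
    (Fintype.card G * Module.finrank ℚ K) • x ∈
      ⨆ χ : G →* Kˣ, chiPart ρ (fun g => ((χ g : Kˣ) : K)) := by
  classical
  haveI : Finite (G →* Kˣ) := finite_monoidHom_units K
  letI : Fintype (G →* Kˣ) := Fintype.ofFinite _
  obtain ⟨T, hT⟩ := exists_int_cast_eq_trace_family (G := G) K
  have key : ((Fintype.card G * Module.finrank ℚ K : ℕ) : ℤ) • x =
      ∑ χ : G →* Kˣ, ∑ g, T χ g • ρ g x := by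
    rw [Finset.sum_comm]
    simp_rw [← Finset.sum_smul, sum_trace_family_eq K hT]
    simp [hone]
  rw [← natCast_zsmul, key]
  exact AddSubgroup.sum_mem _ fun χ _ =>
    AddSubgroup.mem_iSup_of_mem χ (sum_trace_smul_mem_chiPart K ρ hmul χ (hT χ) x)

omit [CharZero K] in
/-- If `ρ(h) x = x` then `ρ(h)` fixes `∑_g T(g) ρ(g) x` (`G` commutative). [folklore] -/
theorem apply_sum_smul_apply_of_apply_eq (ρ : G → M →+ M)
    (hmul : ∀ g h x, ρ (g * h) x = ρ g (ρ h x)) (T : G → ℤ) {x : M} {h : G} (hx : ρ h x = x) :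
    ρ h (∑ g, T g • ρ g x) = ∑ g, T g • ρ g x := by
  rw [map_sum]
  refine Finset.sum_congr rfl fun g _ => ?_
  rw [map_zsmul, ← hmul, mul_comm, hmul, hx]

omit [CharZero K] in
/-- **`χ`-parts of characters non-trivial on `h` contain only torsion `h`-fixed elements.** If
`y ∈ M^(χ)`, `ρ(h) y = y` and `χ(h) ≠ 1` has order `d ≥ 2`, then `a = ∑_{j<d} h^j ∈ I_χ`
(`∑_{j<d} χ(h)^j = 0`) acts on `y` as multiplication by `d`, so `d y = 0` and (`d ∣ exp G`)
`exp(G) · y = 0`. [folklore] -/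
theorem exponent_smul_eq_zero_of_mem_chiPart (ρ : G → M →+ M) (hone : ∀ x, ρ 1 x = x)
    (hmul : ∀ g h x, ρ (g * h) x = ρ g (ρ h x)) (χ : G →* Kˣ) {y : M}
    (hy : y ∈ chiPart ρ (fun g => ((χ g : Kˣ) : K))) {h : G} (hfix : ρ h y = y)
    (hχ : χ h ≠ 1) : Monoid.exponent G • y = 0 := by
  classical
  set u : K := ((χ h : Kˣ) : K) with hu
  have hupow : u ^ Monoid.exponent G = 1 := by
    rw [hu, ← Units.val_pow_eq_pow_val, ← map_pow, Monoid.pow_exponent_eq_one, map_one,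
      Units.val_one]
  set d := orderOf u with hd
  have hdvd : d ∣ Monoid.exponent G := orderOf_dvd_of_pow_eq_one hupow
  have hdpos : 0 < d :=
    orderOf_pos_iff.mpr (isOfFinOrder_iff_pow_eq_one.mpr
      ⟨Monoid.exponent G, Monoid.exponent_pos.mpr Monoid.ExponentExists.of_finite, hupow⟩)
  have hu1 : u ≠ 1 := fun h1 => hχ (Units.ext (by simpa [hu] using h1))
  have hd1 : 1 < d := by
    rcases Nat.lt_or_ge 1 d with h1 | h1
    · exact h1
    · exact absurd (orderOf_eq_one_iff.mp (le_antisymm h1 hdpos)) hu1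
  have hprim : IsPrimitiveRoot u d := IsPrimitiveRoot.orderOf u
  have hfixpow : ∀ j : ℕ, ρ (h ^ j) y = y := by
    intro j
    induction j with
    | zero => simpa using hone y
    | succ j ih => rw [pow_succ, hmul, hfix, ih]
  -- the element `a = ∑_{j<d} [h^j]` of `I_χ`
  set a : G →₀ ℤ := ∑ j ∈ Finset.range d, Finsupp.single (h ^ j) 1 with ha
  have hev : (a.sum fun g n => (n : K) * ((χ g : Kˣ) : K)) = 0 := by
    rw [ha, ← Finsupp.sum_finsetSum_index (fun _ => by simp) (fun _ _ _ => by push_cast; ring)]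
    have hs : ∀ j : ℕ, ((Finsupp.single (h ^ j) (1 : ℤ)).sum fun g n => (n : K) * ((χ g : Kˣ) : K))
        = u ^ j := fun j => by
      rw [Finsupp.sum_single_index (by simp)]
      simp [hu]
    simp_rw [hs]
    exact hprim.geom_sum_eq_zero hd1
  have hact : (a.sum fun g n => n • ρ g y) = (d : ℤ) • y := by
    rw [ha, ← Finsupp.sum_finsetSum_index (fun g => zero_smul ℤ (ρ g y))
      (fun g b₁ b₂ => add_smul b₁ b₂ (ρ g y))]
    have hs : ∀ j : ℕ, ((Finsupp.single (h ^ j) (1 : ℤ)).sum fun g n => n • ρ g y) = y :=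
        fun j => by
      rw [Finsupp.sum_single_index (by simp), one_smul, hfixpow]
    simp_rw [hs]
    simp
  have hdy : d • y = 0 := by
    have := hy a hev
    rw [hact, natCast_zsmul] at this
    exact this
  obtain ⟨k, hk⟩ := hdvd
  rw [hk, mul_comm, ← smul_smul, hdy, smul_zero]

/-- **Isotypic decomposition of `H`-fixed elements by the `χ`-parts of characters trivial on
`H`.** With `G`, `ρ`, `K` as in `card_mul_finrank_smul_mem_iSup_chiPart` and `H ⊂ G` any subset:
if `ρ(h) x = x` for all `h ∈ H` then `(exp G · |G| · [K:ℚ]) x ∈ ∑_{χ|_H = 1} M^(χ)` — in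
`exp(G) ∑_χ t_χ x` the terms with `χ|_H ≠ 1` vanish by `exponent_smul_eq_zero_of_mem_chiPart`
(`t_χ x` is `H`-fixed, `apply_sum_smul_apply_of_apply_eq`). This is the algebra of Galois descent
of Mordell–Weil ranks along `ℚ ⊂ ℚ(ζ_m)^H ⊂ ℚ(ζ_m)` used with Kato's Cor. 14.3 (2). [folklore] -/
theorem exponent_mul_smul_mem_iSup_chiPart_of_forall_apply_eq [FiniteDimensional ℚ K]
    [HasEnoughRootsOfUnity K (Monoid.exponent G)] (ρ : G → M →+ M) (hone : ∀ x, ρ 1 x = x)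
    (hmul : ∀ g h x, ρ (g * h) x = ρ g (ρ h x)) (H : Set G) {x : M}
    (hx : ∀ h ∈ H, ρ h x = x) :
    (Monoid.exponent G * (Fintype.card G * Module.finrank ℚ K)) • x ∈
      ⨆ (χ : G →* Kˣ) (_ : ∀ h ∈ H, χ h = 1), chiPart ρ (fun g => ((χ g : Kˣ) : K)) := by
  classical
  haveI : Finite (G →* Kˣ) := finite_monoidHom_units K
  letI : Fintype (G →* Kˣ) := Fintype.ofFinite _
  obtain ⟨T, hT⟩ := exists_int_cast_eq_trace_family (G := G) K
  have key : ((Fintype.card G * Module.finrank ℚ K : ℕ) : ℤ) • x =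
      ∑ χ : G →* Kˣ, ∑ g, T χ g • ρ g x := by
    rw [Finset.sum_comm]
    simp_rw [← Finset.sum_smul, sum_trace_family_eq K hT]
    simp [hone]
  rw [mul_nsmul', ← natCast_zsmul x, key, Finset.smul_sum]
  refine AddSubgroup.sum_mem _ fun χ _ => ?_
  by_cases hχ : ∀ h ∈ H, χ h = 1
  · exact AddSubgroup.mem_iSup_of_mem χ (AddSubgroup.mem_iSup_of_mem hχ
      (AddSubgroup.nsmul_mem _ (sum_trace_smul_mem_chiPart K ρ hmul χ (hT χ) x) _))
  · push Not at hχ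
    obtain ⟨h, hH, hne⟩ := hχ
    rw [exponent_smul_eq_zero_of_mem_chiPart K ρ hone hmul χ
      (sum_trace_smul_mem_chiPart K ρ hmul χ (hT χ) x)
      (apply_sum_smul_apply_of_apply_eq ρ hmul (T χ) (hx h hH)) hne]
    exact zero_mem _


/-! #### Kato's remark (p. 236): `χ`-parts versus `χ`-quotients -/

omit [Fintype G] in
/-- The character `χ · (σ ∘ χ)⁻¹ : g ↦ σ(χ(g)⁻¹) χ(g)` attached to `σ ∈ Gal(K/ℚ)`; it is trivial
iff `σ` fixes the values of `χ`. [folklore] -/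
theorem coe_mul_inv_map_apply (χ : G →* Kˣ) (σ : K ≃ₐ[ℚ] K) (g : G) :
    (((χ * ((Units.map (σ : K →* K)).comp χ)⁻¹) g : Kˣ) : K) =
      σ ((((χ g)⁻¹ : Kˣ) : K)) * ((χ g : Kˣ) : K) := by
  rw [MonoidHom.mul_apply, MonoidHom.inv_apply, MonoidHom.comp_apply, Units.val_mul, mul_comm,
    ← map_inv, Units.coe_map]
  rfl

/-- **The value of `χ` on its orbit projector**: for `K/ℚ` finite Galois,
`χ(t_χ) = ∑_g Tr(χ(g)⁻¹) χ(g) = ∑_{σ ∈ Gal(K/ℚ)} ∑_g σ(χ(g))⁻¹ χ(g) = |G| · #{σ ; σ ∘ χ = χ}`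
(`Tr = ∑_σ σ`, Mathlib `trace_eq_sum_automorphisms`, and orthogonality `sum_coe_monoidHom_eq` for
the characters `χ (σ ∘ χ)⁻¹`). In particular `χ(t_χ)` is a POSITIVE integer `N_χ`
(`card_mul_card_stabilizer_pos`) and `N_χ · 1 − t_χ ∈ I_χ`. [folklore] -/
theorem sum_trace_mul_eq_card_mul_card [FiniteDimensional ℚ K] [IsGalois ℚ K] (χ : G →* Kˣ)
    {T : G → ℤ} (hT : ∀ g, (T g : ℚ) = Algebra.trace ℚ K (((χ g)⁻¹ : Kˣ) : K))
    [DecidablePred fun σ : K ≃ₐ[ℚ] K => ∀ g, σ ((χ g : Kˣ) : K) = ((χ g : Kˣ) : K)] :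
    (∑ g, (T g : K) * ((χ g : Kˣ) : K)) =
      ((Fintype.card G * (Finset.univ.filter
        (fun σ : K ≃ₐ[ℚ] K => ∀ g, σ ((χ g : Kˣ) : K) = ((χ g : Kˣ) : K))).card : ℕ) : K) := by
  have h1 : ∀ g, (T g : K) = ∑ σ : K ≃ₐ[ℚ] K, σ ((((χ g)⁻¹ : Kˣ) : K)) := fun g => by
    rw [← trace_eq_sum_automorphisms, ← hT g]
    simp
  simp_rw [h1, Finset.sum_mul]
  rw [Finset.sum_comm]
  have h2 : ∀ σ : K ≃ₐ[ℚ] K,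
      (∑ g, σ ((((χ g)⁻¹ : Kˣ) : K)) * ((χ g : Kˣ) : K)) =
        if (∀ g, σ ((χ g : Kˣ) : K) = ((χ g : Kˣ) : K)) then (Fintype.card G : K) else 0 := by
    intro σ
    classical
    have key := sum_coe_monoidHom_eq K (χ * ((Units.map (σ : K →* K)).comp χ)⁻¹)
    simp_rw [coe_mul_inv_map_apply] at key
    rw [key]
    have hiff : (χ * ((Units.map (σ : K →* K)).comp χ)⁻¹ = 1) ↔
        ∀ g, σ ((χ g : Kˣ) : K) = ((χ g : Kˣ) : K) := by
      constructor
      · intro h g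
        have hg := congrArg (fun f : G →* Kˣ => ((f g : Kˣ) : K)) h
        simp only [coe_mul_inv_map_apply, MonoidHom.one_apply, Units.val_one] at hg
        rw [Units.val_inv_eq_inv_val, map_inv₀,
          inv_mul_eq_one₀ ((map_ne_zero σ).mpr (Units.ne_zero _))] at hg
        exact hg
      · intro h
        ext g
        rw [coe_mul_inv_map_apply, MonoidHom.one_apply, Units.val_one, Units.val_inv_eq_inv_val,
          map_inv₀, h, inv_mul_cancel₀ (Units.ne_zero _)]
    simp only [hiff]
  simp_rw [h2]
  rw [Finset.sum_ite, Finset.sum_const_zero, add_zero, Finset.sum_const, nsmul_eq_mul]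
  push_cast
  ring

/-- `N_χ = |G| · #{σ ∈ Gal(K/ℚ) ; σ ∘ χ = χ} > 0` (`σ = 1` qualifies). [folklore] -/
theorem card_mul_card_stabilizer_pos [FiniteDimensional ℚ K] (χ : G →* Kˣ)
    [DecidablePred fun σ : K ≃ₐ[ℚ] K => ∀ g, σ ((χ g : Kˣ) : K) = ((χ g : Kˣ) : K)] :
    0 < Fintype.card G * (Finset.univ.filter
        (fun σ : K ≃ₐ[ℚ] K => ∀ g, σ ((χ g : Kˣ) : K) = ((χ g : Kˣ) : K))).card := by
  refine Nat.mul_pos Fintype.card_pos (Finset.card_pos.mpr ⟨1, ?_⟩)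
  simp

/-- **Kato's remark (Astérisque 295, p. 236), kernel: `M^(χ) ∩ I_χ M` is killed by the non-zero
integer `N_χ`.** Here `I_χ M` is the subgroup generated by the `a · m`, `a ∈ I_χ`, `m ∈ M`
(so `M^(χ) ∩ I_χ M` is the kernel of the canonical map `M^(χ) → M_(χ) = M / I_χ M`), `G` is finite
abelian acting by `ρ`, `χ : G → Kˣ` with `K/ℚ` finite Galois, and
`N_χ = |G| · #{σ ∈ Gal(K/ℚ) ; σ ∘ χ = χ}`. Proof: for `x ∈ M^(χ)`, `N_χ x = t_χ x` since
`N_χ − t_χ ∈ I_χ` (`sum_trace_mul_eq_card_mul_card`); and `t_χ` kills `I_χ M`, because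
`t_χ (a m) = a (t_χ m)` (`G` abelian) with `t_χ m ∈ M^(χ)` (`sum_trace_smul_mem_chiPart`). As
printed: "the kernel and the cokernel of the canonical map `M^(χ) → M_(χ)` are killed by some
non-zero integer". [cite: Kato2004Asterisque, §14 remark after Cor. 14.3 (p. 236)] -/
theorem smul_eq_zero_of_mem_chiPart_of_mem_closure [FiniteDimensional ℚ K] [IsGalois ℚ K]
    (ρ : G → M →+ M) (hone : ∀ x, ρ 1 x = x) (hmul : ∀ g h x, ρ (g * h) x = ρ g (ρ h x))
    (χ : G →* Kˣ)
    [DecidablePred fun σ : K ≃ₐ[ℚ] K => ∀ g, σ ((χ g : Kˣ) : K) = ((χ g : Kˣ) : K)] {x : M}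
    (hx : x ∈ chiPart ρ (fun g => ((χ g : Kˣ) : K)))
    (hxI : x ∈ AddSubgroup.closure {y : M | ∃ (c : G → ℤ) (m : M),
      (∑ g, (c g : K) * ((χ g : Kˣ) : K)) = 0 ∧ y = ∑ g, c g • ρ g m}) :
    (Fintype.card G * (Finset.univ.filter
        (fun σ : K ≃ₐ[ℚ] K => ∀ g, σ ((χ g : Kˣ) : K) = ((χ g : Kˣ) : K))).card) • x = 0 := by
  classical
  obtain ⟨T, hT⟩ := exists_int_cast_eq_trace K χ
  set N := Fintype.card G * (Finset.univ.filter
        (fun σ : K ≃ₐ[ℚ] K => ∀ g, σ ((χ g : Kˣ) : K) = ((χ g : Kˣ) : K))).card with hN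
  have hval := sum_trace_mul_eq_card_mul_card K χ hT
  -- step A: `N • x = t_χ • x`
  have hA : (N : ℤ) • x = ∑ g, T g • ρ g x := by
    have h := (mem_chiPart_iff_fintype ρ _ x).mp hx (fun g => (if g = 1 then (N : ℤ) else 0) - T g)
      (by
        simp only [Int.cast_sub, Int.cast_ite, Int.cast_natCast, Int.cast_zero, sub_mul,
          Finset.sum_sub_distrib, ite_mul, zero_mul, Finset.sum_ite_eq', Finset.mem_univ,
          if_true, map_one, Units.val_one, mul_one]
        rw [hval, ← hN, sub_self])
    simp only [sub_smul, Finset.sum_sub_distrib, ite_smul, zero_smul, Finset.sum_ite_eq',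
      Finset.mem_univ, if_true, hone] at h
    exact sub_eq_zero.mp h
  -- step B: `t_χ` kills `I_χ M`
  let F : M →+ M :=
    { toFun := fun y => ∑ g, T g • ρ g y
      map_zero' := by simp
      map_add' := fun a b => by simp [smul_add, Finset.sum_add_distrib] }
  have hB : x ∈ F.ker := by
    refine (AddSubgroup.closure_le F.ker).mpr (fun y hy => ?_) hxI
    obtain ⟨c, m, hc, rfl⟩ := hy
    rw [SetLike.mem_coe, AddMonoidHom.mem_ker]
    change (∑ g, T g • ρ g (∑ g, c g • ρ g m)) = 0
    rw [sum_smul_apply_sum_smul_comm ρ hmul]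
    exact (mem_chiPart_iff_fintype ρ _ _).mp (sum_trace_smul_mem_chiPart K ρ hmul χ hT m) c hc
  rw [AddMonoidHom.mem_ker] at hB
  change (∑ g, T g • ρ g x) = 0 at hB
  rw [← natCast_zsmul, hA, hB]

/-- **Kato's remark (Astérisque 295, p. 236), cokernel: `N_χ · M ⊂ M^(χ) + I_χ M`**, i.e. the
cokernel of `M^(χ) → M_(χ) = M / I_χ M` is killed by `N_χ = |G| · #{σ ; σ ∘ χ = χ}`: for `y ∈ M`,
`N_χ y = t_χ y + (N_χ − t_χ) y` with `t_χ y ∈ M^(χ)` (`sum_trace_smul_mem_chiPart`) and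
`N_χ − t_χ ∈ I_χ` (`sum_trace_mul_eq_card_mul_card`). Setting as in
`smul_eq_zero_of_mem_chiPart_of_mem_closure`.
[cite: Kato2004Asterisque, §14 remark after Cor. 14.3 (p. 236)] -/
theorem exists_mem_chiPart_sub_mem_closure [FiniteDimensional ℚ K] [IsGalois ℚ K]
    (ρ : G → M →+ M) (hone : ∀ x, ρ 1 x = x) (hmul : ∀ g h x, ρ (g * h) x = ρ g (ρ h x))
    (χ : G →* Kˣ)
    [DecidablePred fun σ : K ≃ₐ[ℚ] K => ∀ g, σ ((χ g : Kˣ) : K) = ((χ g : Kˣ) : K)] (y : M) :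
    ∃ z ∈ chiPart ρ (fun g => ((χ g : Kˣ) : K)),
      (Fintype.card G * (Finset.univ.filter
        (fun σ : K ≃ₐ[ℚ] K => ∀ g, σ ((χ g : Kˣ) : K) = ((χ g : Kˣ) : K))).card) • y - z ∈
      AddSubgroup.closure {y : M | ∃ (c : G → ℤ) (m : M),
        (∑ g, (c g : K) * ((χ g : Kˣ) : K)) = 0 ∧ y = ∑ g, c g • ρ g m} := by
  classical
  obtain ⟨T, hT⟩ := exists_int_cast_eq_trace K χ
  set N := Fintype.card G * (Finset.univ.filter
        (fun σ : K ≃ₐ[ℚ] K => ∀ g, σ ((χ g : Kˣ) : K) = ((χ g : Kˣ) : K))).card with hN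
  have hval := sum_trace_mul_eq_card_mul_card K χ hT
  refine ⟨∑ g, T g • ρ g y, sum_trace_smul_mem_chiPart K ρ hmul χ hT y,
    AddSubgroup.subset_closure ⟨fun g => (if g = 1 then (N : ℤ) else 0) - T g, y, ?_, ?_⟩⟩
  · simp only [Int.cast_sub, Int.cast_ite, Int.cast_natCast, Int.cast_zero, sub_mul,
      Finset.sum_sub_distrib, ite_mul, zero_mul, Finset.sum_ite_eq', Finset.mem_univ,
      if_true, map_one, Units.val_one, mul_one]
    rw [hval, ← hN, sub_self]
  · simp only [sub_smul, Finset.sum_sub_distrib, ite_smul, zero_smul, Finset.sum_ite_eq',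
      Finset.mem_univ, if_true, hone, natCast_zsmul]

end Engine


section Transfer

variable {G : Type*} [CommGroup G] [Fintype G] {M : Type*} [AddCommGroup M]

/-- **Characters with values in a bigger field come from `K`** when `K` has enough `exp(G)`-th
roots of unity: for a field embedding `ι : K → L` and `χ : G → Lˣ` there is `χ' : G → Kˣ` with
`ι ∘ χ' = χ` (the values of `χ` are `exp(G)`-th roots of unity, all of the form `ι(ζ)^i` for a
primitive one `ζ ∈ K`, Mathlib `IsPrimitiveRoot.eq_pow_of_pow_eq_one`). [folklore] -/
theorem exists_monoidHom_map_eq {K L : Type*} [Field K] [Field L]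
    [HasEnoughRootsOfUnity K (Monoid.exponent G)] (ι : K →+* L) (χ : G →* Lˣ) :
    ∃ χ' : G →* Kˣ, ∀ g, ι ((χ' g : Kˣ) : K) = ((χ g : Lˣ) : L) := by
  obtain ⟨ζ, hζ⟩ := HasEnoughRootsOfUnity.exists_primitiveRoot K (Monoid.exponent G)
  have he : Monoid.exponent G ≠ 0 := Monoid.exponent_ne_zero_of_finite
  haveI : NeZero (Monoid.exponent G) := ⟨he⟩
  have hιζ : IsPrimitiveRoot (ι ζ) (Monoid.exponent G) := hζ.map_of_injective ι.injective
  have hex : ∀ g, ∃ i : ℕ, ι ζ ^ i = ((χ g : Lˣ) : L) := fun g => by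
    obtain ⟨i, -, hi⟩ := hιζ.eq_pow_of_pow_eq_one (ξ := ((χ g : Lˣ) : L))
      (by rw [← Units.val_pow_eq_pow_val, ← map_pow, Monoid.pow_exponent_eq_one, map_one,
        Units.val_one])
    exact ⟨i, hi⟩
  choose i hi using hex
  have hζu : IsUnit ζ := hζ.isUnit he
  refine ⟨MonoidHom.mk' (fun g => hζu.unit ^ i g) fun a b => ?_, fun g => ?_⟩
  · ext
    apply ι.injective
    simp [Units.val_mul, map_mul, map_pow, hi]
  · simp [hi]

set_option backward.isDefEq.respectTransparency false in
/-- **Isotypic decomposition by Kato's `χ`-parts, `ℂ`-valued characters.** For a finite abelian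
group `G` acting on an additive group `M` by `ρ` (`ρ(1) = id`, `ρ(gh) = ρ(g) ρ(h)`) there is an
integer `N > 0` (namely `exp(G) · |G| · φ(exp G)`) such that for every subset `H ⊂ G` and every
`x ∈ M` fixed by all `ρ(h)`, `h ∈ H`, `N x ∈ ∑_{χ : G → ℂˣ, χ|_H = 1} M^(χ)`. From the integral
statement over `K = ℚ(ζ_{exp G})` (`exponent_mul_smul_mem_iSup_chiPart_of_forall_apply_eq`)
through an embedding `K ⊂ ℂ` (`chiPart_comp_of_injective`). [folklore] -/
theorem exists_pos_smul_mem_iSup_chiPart_complex (ρ : G → M →+ M) (hone : ∀ x, ρ 1 x = x)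
    (hmul : ∀ g h x, ρ (g * h) x = ρ g (ρ h x)) :
    ∃ N : ℕ, 0 < N ∧ ∀ (H : Set G) (x : M), (∀ h ∈ H, ρ h x = x) →
      N • x ∈ ⨆ (χ : G →* ℂˣ) (_ : ∀ h ∈ H, χ h = 1),
        chiPart ρ (fun g => ((χ g : ℂˣ) : ℂ)) := by
  have he : Monoid.exponent G ≠ 0 := Monoid.exponent_ne_zero_of_finite
  haveI : NeZero (Monoid.exponent G) := ⟨he⟩
  haveI : HasEnoughRootsOfUnity (CyclotomicField (Monoid.exponent G) ℚ) (Monoid.exponent G) :=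
    ⟨⟨IsCyclotomicExtension.zeta (Monoid.exponent G) ℚ (CyclotomicField (Monoid.exponent G) ℚ),
      IsCyclotomicExtension.zeta_spec (Monoid.exponent G) ℚ
        (CyclotomicField (Monoid.exponent G) ℚ)⟩, inferInstance⟩
  obtain ⟨ι⟩ : Nonempty (CyclotomicField (Monoid.exponent G) ℚ →+* ℂ) := by
    rw [← Fintype.card_pos_iff, NumberField.Embeddings.card]
    exact Module.finrank_pos
  refine ⟨Monoid.exponent G *
      (Fintype.card G * Module.finrank ℚ (CyclotomicField (Monoid.exponent G) ℚ)),
    Nat.mul_pos (Nat.pos_of_ne_zero he) (Nat.mul_pos Fintype.card_pos Module.finrank_pos),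
    fun H x hx => ?_⟩
  have hK := exponent_mul_smul_mem_iSup_chiPart_of_forall_apply_eq
    (CyclotomicField (Monoid.exponent G) ℚ) ρ hone hmul H hx
  have hle : (⨆ (χ' : G →* (CyclotomicField (Monoid.exponent G) ℚ)ˣ) (_ : ∀ h ∈ H, χ' h = 1),
      chiPart ρ (fun g => ((χ' g : (CyclotomicField (Monoid.exponent G) ℚ)ˣ) :
        CyclotomicField (Monoid.exponent G) ℚ))) ≤
      ⨆ (χ : G →* ℂˣ) (_ : ∀ h ∈ H, χ h = 1), chiPart ρ (fun g => ((χ g : ℂˣ) : ℂ)) := by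
    refine iSup₂_le fun χ' hχ' => ?_
    have heq : chiPart ρ (fun g => ((χ' g : (CyclotomicField (Monoid.exponent G) ℚ)ˣ) :
        CyclotomicField (Monoid.exponent G) ℚ)) =
        chiPart ρ (fun g => ((((Units.map
          (ι : CyclotomicField (Monoid.exponent G) ℚ →* ℂ)).comp χ') g : ℂˣ) : ℂ)) := by
      rw [← chiPart_comp_of_injective ρ _ ι ι.injective]
      rfl
    rw [heq]
    refine le_iSup₂_of_le ((Units.map (ι : CyclotomicField (Monoid.exponent G) ℚ →* ℂ)).comp χ')
      (fun h hh => ?_) le_rfl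
    ext
    simp [hχ' h hh]
  exact hle hK

/-- **Isotypic decomposition, absolute form**: some `N > 0` has `N x ∈ ∑_{χ : G → ℂˣ} M^(χ)`
for all `x ∈ M` (`H = ∅` in `exists_pos_smul_mem_iSup_chiPart_complex`). Hence `M` is torsion as
soon as all its `χ`-parts are. [folklore] -/
theorem exists_pos_smul_mem_iSup_chiPart_complex' (ρ : G → M →+ M) (hone : ∀ x, ρ 1 x = x)
    (hmul : ∀ g h x, ρ (g * h) x = ρ g (ρ h x)) :
    ∃ N : ℕ, 0 < N ∧ ∀ x : M, N • x ∈ ⨆ χ : G →* ℂˣ, chiPart ρ (fun g => ((χ g : ℂˣ) : ℂ)) := by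
  obtain ⟨N, hN, h⟩ := exists_pos_smul_mem_iSup_chiPart_complex ρ hone hmul
  refine ⟨N, hN, fun x => ?_⟩
  have hx := h ∅ x (fun _ hh => absurd hh (Set.notMem_empty _))
  simpa using hx

set_option backward.isDefEq.respectTransparency false in
/-- **Kato's remark on `χ`-quotients (Astérisque 295, p. 236), as printed, for `χ : G → ℂˣ`**:
"the kernel and the cokernel of the canonical map `M^(χ) → M_(χ)` are killed by some non-zero
integer", `M_(χ) = M / I_χ M`: there is `N > 0` with `N · (M^(χ) ∩ I_χ M) = 0` and
`N · M ⊂ M^(χ) + I_χ M`, where `I_χ M` is the subgroup generated by the `a · m` (`a ∈ I_χ`,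
`m ∈ M`), for any finite abelian `G` acting on `M` by `ρ`. Transferred from the statements over
`K = ℚ(ζ_{exp G})` (`smul_eq_zero_of_mem_chiPart_of_mem_closure`,
`exists_mem_chiPart_sub_mem_closure`) along an embedding `K ⊂ ℂ` and a lift `χ = ι ∘ χ'`
(`exists_monoidHom_map_eq`; `I_χ = I_{χ'}` and `M^(χ) = M^(χ')`, `chiPart_comp_of_injective`).
[cite: Kato2004Asterisque, §14 remark after Cor. 14.3 (p. 236)] -/
theorem exists_pos_chiPart_chiQuotient_complex (ρ : G → M →+ M) (hone : ∀ x, ρ 1 x = x)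
    (hmul : ∀ g h x, ρ (g * h) x = ρ g (ρ h x)) (χ : G →* ℂˣ) :
    ∃ N : ℕ, 0 < N ∧
      (∀ x ∈ chiPart ρ (fun g => ((χ g : ℂˣ) : ℂ)),
        x ∈ AddSubgroup.closure {y : M | ∃ (c : G → ℤ) (m : M),
          (∑ g, (c g : ℂ) * ((χ g : ℂˣ) : ℂ)) = 0 ∧ y = ∑ g, c g • ρ g m} → N • x = 0) ∧
      (∀ y : M, ∃ z ∈ chiPart ρ (fun g => ((χ g : ℂˣ) : ℂ)),
        N • y - z ∈ AddSubgroup.closure {y : M | ∃ (c : G → ℤ) (m : M),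
          (∑ g, (c g : ℂ) * ((χ g : ℂˣ) : ℂ)) = 0 ∧ y = ∑ g, c g • ρ g m}) := by
  classical
  have he : Monoid.exponent G ≠ 0 := Monoid.exponent_ne_zero_of_finite
  haveI : NeZero (Monoid.exponent G) := ⟨he⟩
  haveI : HasEnoughRootsOfUnity (CyclotomicField (Monoid.exponent G) ℚ) (Monoid.exponent G) :=
    ⟨⟨IsCyclotomicExtension.zeta (Monoid.exponent G) ℚ (CyclotomicField (Monoid.exponent G) ℚ),
      IsCyclotomicExtension.zeta_spec (Monoid.exponent G) ℚ
        (CyclotomicField (Monoid.exponent G) ℚ)⟩, inferInstance⟩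
  haveI : IsGalois ℚ (CyclotomicField (Monoid.exponent G) ℚ) :=
    IsCyclotomicExtension.isGalois {Monoid.exponent G} ℚ (CyclotomicField (Monoid.exponent G) ℚ)
  obtain ⟨ι⟩ : Nonempty (CyclotomicField (Monoid.exponent G) ℚ →+* ℂ) := by
    rw [← Fintype.card_pos_iff, NumberField.Embeddings.card]
    exact Module.finrank_pos
  obtain ⟨χ', hχ'⟩ := exists_monoidHom_map_eq ι χ
  have hfun : (fun g => ((χ g : ℂˣ) : ℂ)) =
      fun g => ι ((χ' g : (CyclotomicField (Monoid.exponent G) ℚ)ˣ) :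
        CyclotomicField (Monoid.exponent G) ℚ) := funext fun g => (hχ' g).symm
  have hpart : chiPart ρ (fun g => ((χ g : ℂˣ) : ℂ)) =
      chiPart ρ (fun g => ((χ' g : (CyclotomicField (Monoid.exponent G) ℚ)ˣ) :
        CyclotomicField (Monoid.exponent G) ℚ)) := by
    rw [hfun, chiPart_comp_of_injective ρ _ ι ι.injective]
  have hset : {y : M | ∃ (c : G → ℤ) (m : M),
        (∑ g, (c g : ℂ) * ((χ g : ℂˣ) : ℂ)) = 0 ∧ y = ∑ g, c g • ρ g m} =
      {y : M | ∃ (c : G → ℤ) (m : M),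
        (∑ g, (c g : CyclotomicField (Monoid.exponent G) ℚ) *
          ((χ' g : (CyclotomicField (Monoid.exponent G) ℚ)ˣ) :
            CyclotomicField (Monoid.exponent G) ℚ)) = 0 ∧ y = ∑ g, c g • ρ g m} := by
    ext y
    simp only [Set.mem_setOf_eq]
    refine exists_congr fun c => exists_congr fun m' => and_congr_left fun _ => ?_
    have h : (∑ g, (c g : ℂ) * ((χ g : ℂˣ) : ℂ)) =
        ι (∑ g, (c g : CyclotomicField (Monoid.exponent G) ℚ) *
          ((χ' g : (CyclotomicField (Monoid.exponent G) ℚ)ˣ) :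
            CyclotomicField (Monoid.exponent G) ℚ)) := by
      rw [map_sum]
      refine Finset.sum_congr rfl fun g _ => ?_
      rw [map_mul, map_intCast, hχ']
    rw [h, map_eq_zero_iff ι ι.injective]
  refine ⟨_, card_mul_card_stabilizer_pos (CyclotomicField (Monoid.exponent G) ℚ) χ',
    fun x hx hxI => ?_, fun y => ?_⟩
  · rw [hpart] at hx
    rw [hset] at hxI
    exact smul_eq_zero_of_mem_chiPart_of_mem_closure _ ρ hone hmul χ' hx hxI
  · obtain ⟨z, hz, hmem⟩ :=
      exists_mem_chiPart_sub_mem_closure (CyclotomicField (Monoid.exponent G) ℚ) ρ hone hmul χ' y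
    exact ⟨z, hpart ▸ hz, hset ▸ hmem⟩

/-- **Finite `χ`-parts force torsion fixed points.** Let a finite abelian group `G` act on `M` by
`ρ` and let `H ⊂ G`. If Kato's `χ`-part `M^(χ)` is finite for every character `χ : G → ℂˣ`
trivial on `H`, then every `x ∈ M` fixed by `H` has finite order: a non-zero multiple of `x` lies in
the finite-exponent subgroup `∑_{χ|_H=1} M^(χ)` (`exists_pos_smul_mem_iSup_chiPart_complex`). This
is how the finiteness conclusions of Kato's Thm. 14.2 (2) / Cor. 14.3 (2) for the characters of
`Gal(K/ℚ)` trivial on `H` control `M^H`, e.g. `E(K^H)`. [folklore] -/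
theorem isOfFinAddOrder_of_forall_finite_chiPart (ρ : G → M →+ M) (hone : ∀ x, ρ 1 x = x)
    (hmul : ∀ g h x, ρ (g * h) x = ρ g (ρ h x)) (H : Set G)
    (hfin : ∀ χ : G →* ℂˣ, (∀ h ∈ H, χ h = 1) →
      Finite (chiPart ρ (fun g => ((χ g : ℂˣ) : ℂ))))
    {x : M} (hx : ∀ h ∈ H, ρ h x = x) : IsOfFinAddOrder x := by
  obtain ⟨N, hN, hmem⟩ := exists_pos_smul_mem_iSup_chiPart_complex ρ hone hmul
  have hNx : IsOfFinAddOrder (N • x) := by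
    refine AddSubgroup.iSup_induction (C := fun y => IsOfFinAddOrder y) _ (hmem H x hx)
      (fun χ y hy => ?_) IsOfFinAddOrder.zero (fun a b ha hb => ha.add hb)
    by_cases hχ : ∀ h ∈ H, χ h = 1
    · rw [iSup_pos hχ] at hy
      haveI := hfin χ hχ
      obtain ⟨n, hn, hny⟩ :=
        (isOfFinAddOrder_of_finite (⟨y, hy⟩ : chiPart ρ _)).exists_nsmul_eq_zero
      exact isOfFinAddOrder_iff_nsmul_eq_zero.mpr ⟨n, hn, congrArg Subtype.val hny⟩
    · rw [iSup_neg hχ, AddSubgroup.mem_bot] at hy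
      rw [hy]
      exact IsOfFinAddOrder.zero
  obtain ⟨n, hn, h0⟩ := hNx.exists_nsmul_eq_zero
  exact isOfFinAddOrder_iff_nsmul_eq_zero.mpr ⟨n * N, Nat.mul_pos hn hN, by rw [← smul_smul, h0]⟩

end Transfer

/-! ### `ℚ(ζ_m)`: Dirichlet characters, torsion of fixed points, Kato 14.3 (2) in consumer form -/

section Cyclotomic

open WeierstrassCurve WeierstrassCurve.Affine

variable {m : ℕ} [NeZero m]

set_option backward.isDefEq.respectTransparency false in
/-- Every character `Gal(ℚ(ζ_m)/ℚ) → ℂˣ` is `cyclotomicCharacterOf χ` for a (unique) Dirichlet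
character `χ` mod `m`, through `Gal(ℚ(ζ_m)/ℚ) ≅ (ℤ/m)ˣ` (Mathlib
`IsCyclotomicExtension.autEquivPow`,
`MulChar.equivToUnitHom`) — Kato's identification `(ℤ/m)ˣ ≅ Gal(ℚ(ζ_m)/ℚ) → ℂˣ`, p. 235.
[cite: Kato2004Asterisque, §14 Thm. 14.2 (p. 235)] -/
theorem exists_cyclotomicCharacterOf_eq
    (χ : (CyclotomicField m ℚ ≃ₐ[ℚ] CyclotomicField m ℚ) →* ℂˣ) :
    ∃ χD : DirichletCharacter ℂ m, cyclotomicCharacterOf χD = χ := by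
  set e := IsCyclotomicExtension.autEquivPow (CyclotomicField m ℚ)
    (Polynomial.cyclotomic.irreducible_rat (NeZero.pos m)) with he
  refine ⟨MulChar.ofUnitHom (χ.comp e.symm.toMonoidHom), ?_⟩
  ext σ
  rw [cyclotomicCharacterOf, ← he, MulChar.toUnitHom_eq, MulChar.ofUnitHom_eq,
    Equiv.apply_symm_apply]
  simp

set_option backward.isDefEq.respectTransparency false in
open scoped IsMulCommutative in
/-- **Finite `χ`-parts of `E(ℚ(ζ_m))` force torsion of the points fixed by `H`.** For a
Weierstrass curve `W/ℚ`, `m ≥ 1`, `G = Gal(ℚ(ζ_m)/ℚ)` acting on `E(ℚ(ζ_m))` by `σ ↦ Point.map σ`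
(the action of the tree's Kato facts) and `H ⊂ G`: if the `χ`-part of `E(ℚ(ζ_m))` is finite for
every Dirichlet character `χ` mod `m` with `cyclotomicCharacterOf χ` trivial on `H`, then every
point fixed by `H` — e.g. every point defined over the fixed field `ℚ(ζ_m)^H` — has finite order
(`isOfFinAddOrder_of_forall_finite_chiPart`, `exists_cyclotomicCharacterOf_eq`; `G` is abelian,
Mathlib `IsCyclotomicExtension.isMulCommutative`). [folklore] -/
theorem isOfFinAddOrder_point_of_forall_finite_chiPart (W : WeierstrassCurve ℚ)
    [DecidableEq (CyclotomicField m ℚ)]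
    (H : Set (CyclotomicField m ℚ ≃ₐ[ℚ] CyclotomicField m ℚ))
    (hfin : ∀ χ : DirichletCharacter ℂ m, (∀ h ∈ H, cyclotomicCharacterOf χ h = 1) →
      Finite (chiPart
        (fun σ : CyclotomicField m ℚ ≃ₐ[ℚ] CyclotomicField m ℚ =>
          Point.map (W' := W.toAffine) (σ : CyclotomicField m ℚ →ₐ[ℚ] CyclotomicField m ℚ))
        (fun σ => (cyclotomicCharacterOf χ σ : ℂ))))
    {P : (W.baseChange (CyclotomicField m ℚ)).toAffine.Point}
    (hP : ∀ h ∈ H, Point.map (W' := W.toAffine)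
      (h : CyclotomicField m ℚ →ₐ[ℚ] CyclotomicField m ℚ) P = P) :
    IsOfFinAddOrder P := by
  haveI : IsMulCommutative (CyclotomicField m ℚ ≃ₐ[ℚ] CyclotomicField m ℚ) :=
    IsCyclotomicExtension.isMulCommutative {m} ℚ (CyclotomicField m ℚ)
  refine isOfFinAddOrder_of_forall_finite_chiPart
    (G := CyclotomicField m ℚ ≃ₐ[ℚ] CyclotomicField m ℚ)
    (fun σ => Point.map (W' := W.toAffine) (σ : CyclotomicField m ℚ →ₐ[ℚ] CyclotomicField m ℚ))
    (fun x => by cases x <;> rfl) (fun g h x => by cases x <;> rfl) H (fun χ hχ => ?_) hP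
  obtain ⟨χD, rfl⟩ := exists_cyclotomicCharacterOf_eq χ
  exact hfin χD hχ

set_option backward.isDefEq.respectTransparency false in
/-- **Kato's Cor. 14.3 (2) in consumer form: non-vanishing twisted `L`-values kill the rank over
subfields of `ℚ(ζ_m)`.** Assume the vendored fact `kato_finite_chiPart_of_twistedLValue_ne_zero`
(Kato, Astérisque 295, Cor. 14.3 (2), `K = ℚ(ζ_m)`, least moduli `m ≢ 2 (mod 4)`; it gives every
`m ≥ 1`, `kato_finite_chiPart_cyclotomic_of_twistedLValue_ne_zero_of`). Let `E/ℚ` be an elliptic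
curve with newform `f` (`IsNewformOf W f`), `m ≥ 1`,
`H ⊂ Gal(ℚ(ζ_m)/ℚ)`, and suppose that for every Dirichlet character `χ` mod `m` trivial on `H`
(as a character of the Galois group) the twisted `L`-series `L_{prime(m)}(f, χ, s) = ∑ χ(n) aₙ n⁻ˢ`
has an entire continuation non-vanishing at `s = 1`. Then every point of `E(ℚ(ζ_m))` fixed by `H`
has finite order; in particular `E(ℚ(ζ_m)^H)` is torsion, i.e. finite. (Kato's remark p. 236 and
Thm. 14.4 draw the same kind of consequence; the `χ`-parts for the characters trivial on `H`
exhaust the `H`-fixed part up to bounded torsion,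
`exponent_mul_smul_mem_iSup_chiPart_of_forall_apply_eq`.)
[cite: Kato2004Asterisque, Cor. 14.3 (2) (p. 235)] -/
theorem isOfFinAddOrder_point_of_kato_of_twistedLValue_ne_zero
    (hK : kato_finite_chiPart_of_twistedLValue_ne_zero) (W : WeierstrassCurve ℚ)
    [W.IsElliptic] {N : ℕ} [NeZero N] {f : CuspForm (CongruenceSubgroup.Gamma0 N) 2}
    (hf : ModularForms.IsNewformOf W f) [DecidableEq (CyclotomicField m ℚ)]
    (H : Set (CyclotomicField m ℚ ≃ₐ[ℚ] CyclotomicField m ℚ))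
    (hL : ∀ χ : DirichletCharacter ℂ m, (∀ h ∈ H, cyclotomicCharacterOf χ h = 1) →
      ∃ L : ℂ → ℂ, Differentiable ℂ L ∧
        (∀ s : ℂ, 2 < s.re → L s = ModularForms.twistedLSeries f χ s) ∧ L 1 ≠ 0)
    {P : (W.baseChange (CyclotomicField m ℚ)).toAffine.Point}
    (hP : ∀ h ∈ H, Point.map (W' := W.toAffine)
      (h : CyclotomicField m ℚ →ₐ[ℚ] CyclotomicField m ℚ) P = P) :
    IsOfFinAddOrder P :=
  isOfFinAddOrder_point_of_forall_finite_chiPart W H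
    (fun χ hχ => kato_finite_chiPart_cyclotomic_of_twistedLValue_ne_zero_of hK W hf χ (hL χ hχ)) hP

set_option backward.isDefEq.respectTransparency false in
open scoped Classical in
/-- **`E(ℚ(ζ_m))` is finite when no twisted `L`-value mod `m` vanishes** (under the vendored
Cor. 14.3 (2), `kato_finite_chiPart_of_twistedLValue_ne_zero`, in its all-moduli form
`kato_finite_chiPart_cyclotomic_of_twistedLValue_ne_zero_of`): if
`L_{prime(m)}(f, χ, 1) ≠ 0` for every Dirichlet character `χ` mod `m`, then the finitely generated
group `E(ℚ(ζ_m))` (Mordell–Weil over number fields, `addGroup_fg_point_holds`) is torsion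
(`isOfFinAddOrder_point_of_kato_of_twistedLValue_ne_zero` with `H = ∅`), hence finite (Mathlib
`AddCommGroup.finite_of_fg_torsion`). Compare Kato's Thm. 14.4 (p. 236): `E(ℚ(ζ_{p^∞}))` is
finitely generated, from Cor. 14.3 and Rohrlich's theorem.
[cite: Kato2004Asterisque, Cor. 14.3 (2) (p. 235)] -/
theorem finite_point_cyclotomic_of_kato_of_forall_twistedLValue_ne_zero
    (hK : kato_finite_chiPart_of_twistedLValue_ne_zero) (W : WeierstrassCurve ℚ)
    [W.IsElliptic] {N : ℕ} [NeZero N] {f : CuspForm (CongruenceSubgroup.Gamma0 N) 2}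
    (hf : ModularForms.IsNewformOf W f)
    (hL : ∀ χ : DirichletCharacter ℂ m,
      ∃ L : ℂ → ℂ, Differentiable ℂ L ∧
        (∀ s : ℂ, 2 < s.re → L s = ModularForms.twistedLSeries f χ s) ∧ L 1 ≠ 0) :
    Finite (W.baseChange (CyclotomicField m ℚ)).toAffine.Point := by
  haveI : (W.baseChange (CyclotomicField m ℚ)).IsElliptic := by
    rw [WeierstrassCurve.baseChange]; infer_instance
  haveI : AddGroup.FG (W.baseChange (CyclotomicField m ℚ)).toAffine.Point :=
    (W.baseChange (CyclotomicField m ℚ)).addGroup_fg_point_holds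
  refine AddCommGroup.finite_of_fg_torsion _ fun P => ?_
  exact isOfFinAddOrder_point_of_kato_of_twistedLValue_ne_zero hK W hf ∅ (fun χ _ => hL χ)
    (fun _ hh => absurd hh (Set.notMem_empty _))

end Cyclotomic

end Literature.NumberTheory.EllipticCurves

end
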